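import Literature.NumberTheory.LFunctions.MatomakiRadziwillTaoPropA3WindowSqSharp
import Literature.NumberTheory.LFunctions.MatomakiRadziwillTaoT2Mult
import Literature.NumberTheory.LFunctions.TaoLogElliottCMization
import HarnessLib

/-!
# Matomäki–Radziwiłł–Tao 2015, Proposition A.3 — the discharge of the named fact

Topic `Literature/NumberTheory/LFunctions`.  Everything in this file is PROVED; no definitions, no named facts.

K. Matomäki, M. Radziwiłł, T. Tao, *An averaged form of Chowla's conjecture*, Algebra & Number Theory **9** (2015),
Appendix A, Proposition A.3 (= arXiv:1503.05121 §6, Prop. 6.3): for a `1`-bounded multiplicative `f`, the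
`𝒮`-restricted polynomial `F(s) = ∑_{X ≤ n ≤ 2X, n ∈ 𝒮} f(n) n^{-s}` satisfies, for any `T`,
`∫_0^T |F(1+it)|² dt ≪ (T/(X/Q₁) + 1)((log Q₁)^{1/3}/P₁^{1/6-η} + e^{-M(f;X)} M(f;X) + (log X)^{-1/50})`.
The tree vendors this AS PRINTED as the named fact `MatomakiRadziwillTao2015_propA3`
(`MatomakiRadziwillTaoPropA3.lean`, middle term rendered `(1 + M) e^{-M}`).  This file proves it.

## Part 1 — the window `|t - t₁| ≤ 2(log X)^{1/16}` for MULTIPLICATIVE `f`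

The restricted Halász machinery of the tree (Euler products of `𝒮`-restricted sums, `HalaszRestricted*.lean`), hence
the window bound `MRT2015.integral_sq_restr_window_le_exp` (`MatomakiRadziwillTaoPropA3WindowSqSharp.lean`: the sharp
restricted Halász theorem `Halasz.Restricted.norm_restr_interval_sum_le_sharp` — main term `e^{-M/2}` WITHOUT the factor
`1 + M` — squared by Gallagher's lemma), is written for completely multiplicative functions.  The reduction:

* `f = f⋆ ∗ h` (Dirichlet convolution) with `f⋆ = cmLift f` completely multiplicative, `f⋆(p) = f(p)`, and
  `h = cmDefect f`, `h(p^k) = f(p^k) - f(p) f(p^{k-1})`, so `h(p) = 0`, `|h(p^k)| ≤ 2` — the tree's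
  `TaoLogElliottCMization.lean` (`cmLift_mul_cmDefect`, `cmDefect_prime`, `norm_cmDefect_prime_pow_le`), written for
  Tao's reduction to completely multiplicative functions in the log-averaged Elliott conjecture and reused here;
* hence (`restrDirichlet_eq_sum_corr`) the restricted polynomial decomposes EXACTLY as
  `F(1+it) = ∑_{a ≤ 2X} h(a) a^{-1-it} G_a(1+it)`, `G_a(s) = ∑_{X/a ≤ m ≤ 2X/a, m ∈ 𝒮(𝓙_a)} f⋆(m) m^{-s}`, where
  `𝒮(𝓙_a)` is the restricted set for the SUB-family `𝓙_a = {j : no prime of [P_j, Q_j] divides a}` of blocks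
  (`am ∈ 𝒮 ⟺ m ∈ 𝒮(𝓙_a)`, `memBlocks_mul_iff`);
* by Cauchy–Schwarz with the weights `|h(a)| a^{-2/3}` (whose sum is `≤ C`: the tree's `sum_defectWeight_le`,
  an Euler product over powerful numbers), `∫ |F|² ≤ C ∑_a |h(a)| a^{-4/3} ∫ |G_a|²`; for `a ≤ (log X)^{1/4}` the window
  theorem at the scale `X/a` for the sub-family `𝓙_a` gives `∫ |G_a|² ≤ K(e^{-M} + (log X)^{-1/50})` (the distances
  of `f⋆` and `f` coincide, `pretentiousDistSq_cmLift`), and for `a > (log X)^{1/4}` the trivial bound `|G_a| ≤ 2`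
  and `a^{-4/3} ≤ a^{-2/3} (log X)^{-1/6}` suffice (`(log X)^{1/16 - 1/6} ≤ (log X)^{-1/50}`).

Result: `MRT2015.integral_sq_restrDirichlet_window_le_exp_mult` — for all large `X`, `0 < η ≤ 1`,
`I : SieveIntervalSystem η X₀` with `√X ≤ X₀ ≤ X`, multiplicative `1`-bounded `f : ArithmeticFunction ℂ`, `t₁` with
`𝔻(f, n^{it₁}; X)² ≤ M + 1`
and `[a, b] ⊆ [t₁ - 2(log X)^{1/16}, t₁ + 2(log X)^{1/16}] ∩ [-X/2, X/2]`:
`∫_a^b |F(1+it)|² dt ≤ K (e^{-M} + (log X)^{-1/50})`, `F = MRT2015.restrDirichlet f I X`, `M = M(f; X)`.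

## Part 2 — Proposition A.3

* `MRT2015.propA3_mult_exp` — Proposition A.3 for multiplicative `f` with the BETTER middle term `K e^{-M}`:
  for `T ≥ X/2` the mean value theorem (`integral_restrDirichlet_trivial_le`); for `T < X/2` (and, as one may,
  `T ≥ 1`: both sides are monotone in `T`) the range `[0, T]` is split at `a = clamp(t₁ - L)` (replaced by `0` when
  `< 1`) and `b = clamp(t₁ + L)`, `L = (log X)^{1/16}`, `t₁` the minimiser of `u ↦ 𝔻(f, n^{iu}; X)²` on `|u| ≤ X`;
  the pieces `[0, a]`, `[b, T]` of `𝒯₂` are bounded by `MRT2015.T2one_mult_of_vk` (Matomäki–Radziwiłł's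
  Proposition 1 and Lemma A.4, `MatomakiRadziwillTaoT2Mult.lean`, from the Vinogradov–Korobov region of the tree
  `VKZeta.exists_hasVKZeroFreeRegion`), the window `[a, b] ⊆ [t₁ - 2L, t₁ + 2L]` by Part 1;
* `MatomakiRadziwillTao2015_propA3_holds : MatomakiRadziwillTao2015_propA3` — the named fact (`e^{-M} ≤ (1+M)e^{-M}`);
* `MRT2015.propA3With_exp` — the schema instance `∃ K ≥ 0, PropA3With (fun M => K e^{-M})` for completely
  multiplicative `f` (better than the printed middle term).

On the printed proof.  Its step "`F(1+it) ≪ e^{-M} M` by Halász's theorem for `t ∈ 𝒯₀`" treats the restricted sum as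
an unrestricted one; for `𝒮`-restricted sums the pointwise Halász bound only gives `e^{-M/2}`-type decay (see the
Status section of `MatomakiRadziwillTaoPropA3.lean`).  The `L²` statement is nevertheless true: integrating a refined
Granville–Soundararajan `α`-profile for restricted sums over the window in mean square (Gallagher) squares the pointwise
saving, `(e^{-M/2})² = e^{-M}`.

## References
* K. Matomäki, M. Radziwiłł, T. Tao, Algebra & Number Theory 9 (2015), 2167–2196; arXiv:1503.05121 §6:
  Proposition 6.3 (= A.3) and its proof, Lemma 6.4 (= A.4). [cite: MatomakiRadziwillTao2015, Appendix A, Proposition A.3]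
* K. Matomäki, M. Radziwiłł, Ann. of Math. (2) 183 (2016), Proposition 1, §8. [cite: MatomakiRadziwillAnnals2016, Proposition 1]
* A. Granville, K. Soundararajan, *Decay of mean values of multiplicative functions*, Canad. J. Math. 55 (2003).
  [cite: GranvilleSoundararajan2003, Theorem 1]

## Design choices
* `f : ArithmeticFunction ℂ` with `f.IsMultiplicative`, as in the named fact; the decomposition `f = f⋆ ∗ h` and the
  weight bound are the tree's (`TaoLogElliottCMization.lean`); everything else is finite sums.
* T. Tao, Forum Math. Pi 4 (2016), proof of Proposition 2.2, is where the device `f = f⋆ ∗ h`,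
  `∑_d |h(d)| d^{-2/3} = O(1)` is printed. [cite: TaoFMP2016, proof of Proposition 2.2]
-/

noncomputable section

open Finset Real Complex Filter MeasureTheory ArithmeticFunction
open scoped ComplexConjugate Classical

namespace Literature.NumberTheory.LFunctions

namespace MRT2015

open Sieve (SieveIntervalSystem minPretentiousDistSq minPretentiousDistSq_nonneg pretentiousDistSq)
open Halasz.Restricted (MemBlocks IsBlockSystem)

/-! ### `f⋆ = cmLift f` and `h = cmDefect f` (tree, `TaoLogElliottCMization.lean`): what Part 1 needs -/

/-- The pretentious distance only sees prime values: `𝔻(f⋆, w; x) = 𝔻(f, w; x)`. [folklore] -/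
theorem pretentiousDistSq_cmLift (f : ArithmeticFunction ℂ) (w : ℕ → ℂ) (x : ℝ) :
    pretentiousDistSq (cmLift f) w x = pretentiousDistSq f w x := by
  unfold Sieve.pretentiousDistSq
  refine Finset.sum_congr rfl fun p hp => ?_
  rw [cmLift_prime f (Nat.mem_primesLE.1 hp).2]

/-- `M(f⋆; X, T) = M(f; X, T)`. [folklore] -/
theorem minPretentiousDistSq_cmLift (f : ArithmeticFunction ℂ) (X T : ℝ) :
    minPretentiousDistSq (cmLift f) X T = minPretentiousDistSq f X T := by
  unfold Sieve.minPretentiousDistSq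
  simp_rw [pretentiousDistSq_cmLift]

/-- `f(n) = ∑_{am = n} h(a) f⋆(m)` (`f = f⋆ ∗ h`, `cmLift_mul_cmDefect`). [folklore] -/
theorem apply_eq_sum_cmDefect (f : ArithmeticFunction ℂ) (n : ℕ) :
    f n = ∑ x ∈ n.divisorsAntidiagonal, cmDefect f x.1 * cmLift f x.2 := by
  have h := congrArg (fun g : ArithmeticFunction ℂ => g n) (cmLift_mul_cmDefect f)
  rw [mul_comm, ArithmeticFunction.mul_apply] at h
  exact h.symm

/-! ### The decomposition of the restricted polynomial -/

/-- Membership in `𝒮` of a product: for blocks of primes, `am ∈ 𝒮(𝓙) ⟺ m ∈ 𝒮(𝓙_a)`,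
`𝓙_a = {j ∈ 𝓙 : no prime of the block j divides a}`. [folklore] -/
theorem memBlocks_mul_iff {𝓙 : Finset ℕ} {blk : ℕ → Finset ℕ} (hprime : ∀ j ∈ 𝓙, ∀ p ∈ blk j, p.Prime)
    (a m : ℕ) :
    MemBlocks 𝓙 blk (a * m) ↔ MemBlocks (𝓙.filter fun j => ∀ p ∈ blk j, ¬ p ∣ a) blk m := by
  unfold Halasz.Restricted.MemBlocks
  constructor
  · intro h j hj
    rw [Finset.mem_filter] at hj
    obtain ⟨p, hp, hpd⟩ := h j hj.1
    refine ⟨p, hp, ?_⟩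
    rcases (Nat.Prime.dvd_mul (hprime j hj.1 p hp)).1 hpd with h1 | h1
    · exact absurd h1 (hj.2 p hp)
    · exact h1
  · intro h j hj
    by_cases hja : ∀ p ∈ blk j, ¬ p ∣ a
    · obtain ⟨p, hp, hpd⟩ := h j (Finset.mem_filter.2 ⟨hj, hja⟩)
      exact ⟨p, hp, dvd_mul_of_dvd_right hpd a⟩
    · push Not at hja
      obtain ⟨p, hp, hpd⟩ := hja
      exact ⟨p, hp, dvd_mul_of_dvd_left hpd m⟩

variable {η X₀ : ℝ}

/-- The prime blocks of an interval system consist of primes. [folklore] -/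
private theorem primeBlock_prime (I : SieveIntervalSystem η X₀) :
    ∀ j ∈ Finset.Icc 1 I.J, ∀ p ∈ (Finset.Icc ⌈I.P j⌉₊ ⌊I.Q j⌋₊).filter Nat.Prime, p.Prime :=
  fun _ _ _ hp => (Finset.mem_filter.1 hp).2

/-- The fibre of the decomposition: for `a ≥ 1`, `X > 0`,
`{m ≤ ⌊2X⌋ : 1 ≤ m, am ∈ [⌈X⌉, ⌊2X⌋] ∩ 𝒮(𝓙)} = [⌈X/a⌉, ⌊2(X/a)⌋] ∩ 𝒮(𝓙_a)`. [folklore] -/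
theorem fibre_eq (I : SieveIntervalSystem η X₀) {X : ℝ} (hX : 0 < X) (𝓙 : Finset ℕ) (h𝓙 : 𝓙 ⊆ Finset.Icc 1 I.J)
    {a : ℕ} (ha : 1 ≤ a) :
    (Finset.Icc 1 ⌊2 * X⌋₊).filter (fun m => a * m ∈ (Finset.Icc ⌈X⌉₊ ⌊2 * X⌋₊).filter
        (MemBlocks 𝓙 (fun j => (Finset.Icc ⌈I.P j⌉₊ ⌊I.Q j⌋₊).filter Nat.Prime))) =
      (Finset.Icc ⌈X / a⌉₊ ⌊2 * (X / a)⌋₊).filter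
        (MemBlocks (𝓙.filter fun j => ∀ p ∈ (Finset.Icc ⌈I.P j⌉₊ ⌊I.Q j⌋₊).filter Nat.Prime, ¬ p ∣ a)
          (fun j => (Finset.Icc ⌈I.P j⌉₊ ⌊I.Q j⌋₊).filter Nat.Prime)) := by
  have ha0 : (0 : ℝ) < a := by exact_mod_cast ha
  have hprime : ∀ j ∈ 𝓙, ∀ p ∈ (Finset.Icc ⌈I.P j⌉₊ ⌊I.Q j⌋₊).filter Nat.Prime, p.Prime :=
    fun j hj p hp => primeBlock_prime I j (h𝓙 hj) p hp
  ext m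
  simp only [Finset.mem_filter, Finset.mem_Icc, memBlocks_mul_iff hprime a m]
  constructor
  · rintro ⟨⟨hm1, _⟩, ⟨hlo, hhi⟩, hmem⟩
    refine ⟨⟨?_, ?_⟩, hmem⟩
    · -- `X ≤ a m` so `X/a ≤ m`
      have h1 : X ≤ (a * m : ℕ) := (Nat.ceil_le).1 hlo
      rw [Nat.cast_mul] at h1
      refine Nat.ceil_le.2 ?_
      rw [div_le_iff₀' ha0]; exact h1
    · have h1 : ((a * m : ℕ) : ℝ) ≤ 2 * X := (Nat.le_floor_iff (by linarith)).1 hhi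
      rw [Nat.cast_mul] at h1
      refine Nat.le_floor ?_
      rw [← mul_div_assoc, le_div_iff₀' ha0]; exact h1
  · rintro ⟨⟨hlo, hhi⟩, hmem⟩
    have h1 : X / a ≤ m := (Nat.ceil_le).1 hlo
    have h2 : (m : ℝ) ≤ 2 * (X / a) := (Nat.le_floor_iff (by positivity)).1 hhi
    have hXam : X ≤ (a : ℝ) * m := by rwa [div_le_iff₀' ha0] at h1
    have ham2 : (a : ℝ) * m ≤ 2 * X := by
      rw [← mul_div_assoc, le_div_iff₀' ha0] at h2; exact h2
    have hm1 : 1 ≤ m := by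
      have : 0 < (m : ℝ) := lt_of_lt_of_le (div_pos hX ha0) h1
      exact_mod_cast this
    refine ⟨⟨hm1, ?_⟩, ⟨?_, ?_⟩, hmem⟩
    · refine Nat.le_floor ?_
      have : (m : ℝ) ≤ a * m := le_mul_of_one_le_left (Nat.cast_nonneg m) (by exact_mod_cast ha)
      linarith
    · exact Nat.ceil_le.2 (by exact_mod_cast hXam)
    · exact Nat.le_floor (by exact_mod_cast ham2)

/-- **The exact decomposition `F_f = ∑_a h(a) a^{-s} G_a`** of the restricted polynomial
(`s = 1 + it`, sub-families `𝓙_a`, scales `X/a`). [folklore] -/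
theorem restrDirichlet_eq_sum_corr (f : ArithmeticFunction ℂ) (I : SieveIntervalSystem η X₀) {X : ℝ} (hX : 0 < X)
    (t : ℝ) :
    restrDirichlet f I X t =
      ∑ a ∈ Finset.Icc 1 ⌊2 * X⌋₊, cmDefect f a * (a : ℂ) ^ (-(1 + (t : ℂ) * Complex.I)) *
        ∑ m ∈ (Finset.Icc ⌈X / a⌉₊ ⌊2 * (X / a)⌋₊).filter
          (MemBlocks ((Finset.Icc 1 I.J).filter fun j => ∀ p ∈ (Finset.Icc ⌈I.P j⌉₊ ⌊I.Q j⌋₊).filter Nat.Prime,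
              ¬ p ∣ a) (fun j => (Finset.Icc ⌈I.P j⌉₊ ⌊I.Q j⌋₊).filter Nat.Prime)),
          cmLift f m * (m : ℂ) ^ (-(1 + (t : ℂ) * Complex.I)) := by
  set s : ℂ := -(1 + (t : ℂ) * Complex.I) with hs
  set blk : ℕ → Finset ℕ := fun j => (Finset.Icc ⌈I.P j⌉₊ ⌊I.Q j⌋₊).filter Nat.Prime with hblk
  set S : Finset ℕ := (Finset.Icc ⌈X⌉₊ ⌊2 * X⌋₊).filter (MemBlocks (Finset.Icc 1 I.J) blk) with hS
  set N : ℕ := ⌊2 * X⌋₊ with hN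
  rw [restrDirichlet_eq_sum_memBlocks f I hX t]
  -- Step 1: `f n n^{-s} = ∑_{am = n} (h(a) a^{-s}) (f⋆(m) m^{-s})`
  have hstep1 : ∀ n ∈ S, f n * (n : ℂ) ^ s =
      ∑ x ∈ n.divisorsAntidiagonal, (cmDefect f x.1 * (x.1 : ℂ) ^ s) * (cmLift f x.2 * (x.2 : ℂ) ^ s) := by
    intro n _
    rw [apply_eq_sum_cmDefect f n, Finset.sum_mul]
    refine Finset.sum_congr rfl fun x hx => ?_
    rw [Nat.mem_divisorsAntidiagonal] at hx
    rw [← hx.1, Nat.cast_mul, Complex.natCast_mul_natCast_cpow]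
    ring
  rw [Finset.sum_congr rfl hstep1, Finset.sum_sigma']
  -- Step 2: reindex the pairs `(n, (a, m))` by `(a, m)` with `am ∈ S`
  have hSsub : ∀ n ∈ S, n ≤ N := by
    intro n hn
    rw [hS, Finset.mem_filter, Finset.mem_Icc] at hn
    exact hn.1.2
  rw [Finset.sum_bij' (s := S.sigma fun n => n.divisorsAntidiagonal)
      (t := (Finset.Icc 1 N ×ˢ Finset.Icc 1 N).filter fun y => y.1 * y.2 ∈ S)
      (i := fun y _ => y.2) (j := fun y _ => ⟨y.1 * y.2, y⟩)
      (g := fun y => (cmDefect f y.1 * (y.1 : ℂ) ^ s) * (cmLift f y.2 * (y.2 : ℂ) ^ s))]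
  rotate_left
  · -- `i` maps into `t`
    rintro ⟨n, ⟨a, m⟩⟩ hy
    rw [Finset.mem_sigma] at hy
    obtain ⟨hn, ham⟩ := hy
    rw [Nat.mem_divisorsAntidiagonal] at ham
    obtain ⟨hamn, hn0⟩ := ham
    simp only at hamn
    have hnN := hSsub n hn
    have ha0 : a ≠ 0 := fun h => hn0 (by rw [← hamn, h, zero_mul])
    have hm0 : m ≠ 0 := fun h => hn0 (by rw [← hamn, h, mul_zero])
    simp only [Finset.mem_filter, Finset.mem_product, Finset.mem_Icc]
    refine ⟨⟨⟨Nat.one_le_iff_ne_zero.2 ha0, ?_⟩, Nat.one_le_iff_ne_zero.2 hm0, ?_⟩, by rwa [hamn]⟩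
    · calc a ≤ a * m := Nat.le_mul_of_pos_right a (Nat.pos_of_ne_zero hm0)
        _ = n := hamn
        _ ≤ N := hnN
    · calc m ≤ a * m := Nat.le_mul_of_pos_left m (Nat.pos_of_ne_zero ha0)
        _ = n := hamn
        _ ≤ N := hnN
  · -- `j` maps into `s`
    rintro ⟨a, m⟩ hy
    simp only [Finset.mem_filter, Finset.mem_product, Finset.mem_Icc] at hy
    rw [Finset.mem_sigma, Nat.mem_divisorsAntidiagonal]
    refine ⟨hy.2, rfl, ?_⟩
    exact Nat.mul_ne_zero (by omega) (by omega)
  · -- left inverse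
    rintro ⟨n, ⟨a, m⟩⟩ hy
    rw [Finset.mem_sigma, Nat.mem_divisorsAntidiagonal] at hy
    obtain ⟨_, hamn, _⟩ := hy
    simp only at hamn
    simp [hamn]
  · -- right inverse
    rintro ⟨a, m⟩ _
    rfl
  · -- the summands agree
    rintro ⟨n, ⟨a, m⟩⟩ _
    rfl
  -- Step 3: the sum over the filtered product is the iterated sum
  rw [Finset.sum_filter, Finset.sum_product]
  refine Finset.sum_congr rfl fun a ha => ?_
  have ha1 : 1 ≤ a := (Finset.mem_Icc.1 ha).1
  rw [← Finset.sum_filter, Finset.mul_sum]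
  rw [fibre_eq I hX (Finset.Icc 1 I.J) le_rfl ha1]

/-! ### The trivial bound for the fibres -/

/-- `|G_a(1+it)| ≤ 2`: a sum of `≤ 2⌈Y⌉` terms of size `≤ 1/⌈Y⌉` (`Y = X/a > 0`). [folklore] -/
theorem norm_fibre_le {g : ℕ → ℂ} (hg : ∀ n, ‖g n‖ ≤ 1) {Y : ℝ} (hY : 0 < Y) (𝓙 : Finset ℕ) (blk : ℕ → Finset ℕ)
    (t : ℝ) :
    ‖∑ m ∈ (Finset.Icc ⌈Y⌉₊ ⌊2 * Y⌋₊).filter (MemBlocks 𝓙 blk), g m * (m : ℂ) ^ (-(1 + (t : ℂ) * Complex.I))‖ ≤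
      2 := by
  set c : ℕ := ⌈Y⌉₊ with hc
  have hc1 : 1 ≤ c := Nat.one_le_iff_ne_zero.2 (by rw [hc]; simpa using hY)
  have hc0 : (0 : ℝ) < c := by exact_mod_cast hc1
  have hterm : ∀ m ∈ (Finset.Icc c ⌊2 * Y⌋₊).filter (MemBlocks 𝓙 blk),
      ‖g m * (m : ℂ) ^ (-(1 + (t : ℂ) * Complex.I))‖ ≤ 1 / c := by
    intro m hm
    rw [Finset.mem_filter, Finset.mem_Icc] at hm
    have hm0 : 0 < m := by omega
    rw [norm_mul, Complex.norm_natCast_cpow_of_pos hm0]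
    simp only [Complex.neg_re, Complex.add_re, Complex.one_re, Complex.mul_re, Complex.ofReal_re,
      Complex.I_re, mul_zero, Complex.ofReal_im, Complex.I_im, mul_one, sub_self, add_zero]
    rw [Real.rpow_neg (Nat.cast_nonneg m), Real.rpow_one]
    have h1 : ((m : ℝ))⁻¹ ≤ 1 / c := by
      rw [inv_eq_one_div]
      exact one_div_le_one_div_of_le hc0 (by exact_mod_cast hm.1.1)
    calc ‖g m‖ * ((m : ℝ))⁻¹ ≤ 1 * ((m : ℝ))⁻¹ := mul_le_mul_of_nonneg_right (hg m) (by positivity)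
      _ ≤ 1 / c := by rw [one_mul]; exact h1
  refine (norm_sum_le _ _).trans ((Finset.sum_le_card_nsmul _ _ _ hterm).trans ?_)
  rw [nsmul_eq_mul]
  have hcard : (((Finset.Icc c ⌊2 * Y⌋₊).filter (MemBlocks 𝓙 blk)).card : ℝ) ≤ 2 * c := by
    have h1 : ((Finset.Icc c ⌊2 * Y⌋₊).filter (MemBlocks 𝓙 blk)).card ≤ ⌊2 * Y⌋₊ + 1 - c :=
      (Finset.card_filter_le _ _).trans (by rw [Nat.card_Icc])
    have h2 : (⌊2 * Y⌋₊ : ℝ) ≤ 2 * Y := Nat.floor_le (by linarith)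
    have h3 : Y ≤ c := Nat.le_ceil Y
    have h4 : ⌊2 * Y⌋₊ + 1 - c ≤ 2 * c := by
      have : (⌊2 * Y⌋₊ : ℝ) ≤ 2 * c := by linarith
      have : ⌊2 * Y⌋₊ ≤ 2 * c := by exact_mod_cast this
      omega
    exact_mod_cast h1.trans h4
  calc (((Finset.Icc c ⌊2 * Y⌋₊).filter (MemBlocks 𝓙 blk)).card : ℝ) * (1 / c) ≤ 2 * c * (1 / c) :=
        mul_le_mul_of_nonneg_right hcard (by positivity)
    _ = 2 := by field_simp

/-! ### The window bound for multiplicative `f` -/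

set_option maxHeartbeats 1600000 in
/-- **The window of Proposition A.3 in `L²` for MULTIPLICATIVE `f`, middle term `e^{-M}`.**  See the module
docstring. [cite: MatomakiRadziwillTao2015, Appendix A, Proposition A.3 (proof)] -/
theorem integral_sq_restrDirichlet_window_le_exp_mult :
    ∃ K : ℝ, 0 < K ∧ ∀ᶠ X : ℝ in atTop, ∀ (η X₀ : ℝ) (I : SieveIntervalSystem η X₀) (f : ArithmeticFunction ℂ),
      0 < η → η ≤ 1 → f.IsMultiplicative → (∀ n, ‖f n‖ ≤ 1) →
      Real.sqrt X ≤ X₀ → X₀ ≤ X →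
      ∀ (t₁ a b : ℝ),
        pretentiousDistSq f (fun n : ℕ => (n : ℂ) ^ ((t₁ : ℂ) * Complex.I)) X ≤ minPretentiousDistSq f X X + 1 →
        a ≤ b → t₁ - 2 * Real.log X ^ (1 / 16 : ℝ) ≤ a → b ≤ t₁ + 2 * Real.log X ^ (1 / 16 : ℝ) →
        -(X / 2) ≤ a → b ≤ X / 2 →
        ∫ t in a..b, ‖restrDirichlet f I X t‖ ^ 2 ≤
          K * (Real.exp (-minPretentiousDistSq f X X) + 1 / Real.log X ^ (1 / 50 : ℝ)) := by
  obtain ⟨K, hK, hev⟩ := integral_sq_restr_window_le_exp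
  have hCB : 0 < cmDefectBound := by unfold cmDefectBound; exact Real.exp_pos _
  refine ⟨cmDefectBound * cmDefectBound * (K + 16), by positivity, ?_⟩
  filter_upwards [hev, eventually_ge_atTop (16 : ℝ), Real.tendsto_log_atTop.eventually_ge_atTop (1 : ℝ)]
    with X hW hX16 hℓ1
  intro η X₀ I f hη hη1 hf hfb hX₀ hX₀X t₁ a b hmin hab ha hb haX hbX
  have hX0 : 0 < X := by linarith
  set ℓ : ℝ := Real.log X with hℓdef
  have hℓ0 : 0 < ℓ := by linarith
  set L : ℝ := ℓ ^ (1 / 16 : ℝ) with hLdef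
  set A : ℝ := ℓ ^ (1 / 4 : ℝ) with hAdef
  have hA0 : 0 < A := Real.rpow_pos_of_pos hℓ0 _
  set M : ℝ := minPretentiousDistSq f X X with hMdef
  set blk : ℕ → Finset ℕ := fun j => (Finset.Icc ⌈I.P j⌉₊ ⌊I.Q j⌋₊).filter Nat.Prime with hblk
  set 𝓙a : ℕ → Finset ℕ := fun a => (Finset.Icc 1 I.J).filter fun j => ∀ p ∈ blk j, ¬ p ∣ a with h𝓙a
  set G : ℕ → ℝ → ℂ := fun a t => ∑ m ∈ (Finset.Icc ⌈X / a⌉₊ ⌊2 * (X / a)⌋₊).filter (MemBlocks (𝓙a a) blk),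
      cmLift f m * (m : ℂ) ^ (-(1 + (t : ℂ) * Complex.I)) with hG
  set N : ℕ := ⌊2 * X⌋₊ with hN
  set c : ℕ → ℝ := fun a => ‖cmDefect f a‖ * (a : ℝ) ^ (-(2 / 3 : ℝ)) with hc
  have hc0 : ∀ a, 0 ≤ c a := fun a => mul_nonneg (norm_nonneg _) (Real.rpow_nonneg (Nat.cast_nonneg a) _)
  have hcsum : ∑ a ∈ Finset.Icc 1 N, c a ≤ cmDefectBound := sum_defectWeight_le f hf hfb N
  have hcm_mul : ∀ m n, cmLift f (m * n) = cmLift f m * cmLift f n := cmLift_mul f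
  have hcm_one : cmLift f 1 = 1 := cmLift_one f
  have hcm_b : ∀ n, ‖cmLift f n‖ ≤ 1 := norm_cmLift_le_one f fun p _ => hfb p
  -- pointwise: `‖F(t)‖² ≤ C ∑_a c(a) a^{-2/3} ‖G_a(t)‖²`
  have hpt : ∀ t : ℝ, ‖restrDirichlet f I X t‖ ^ 2 ≤
      cmDefectBound * ∑ a ∈ Finset.Icc 1 N, c a * ((a : ℝ) ^ (-(2 / 3 : ℝ)) * ‖G a t‖ ^ 2) := by
    intro t
    have hEq : restrDirichlet f I X t =
        ∑ a ∈ Finset.Icc 1 N, cmDefect f a * (a : ℂ) ^ (-(1 + (t : ℂ) * Complex.I)) * G a t :=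
      restrDirichlet_eq_sum_corr f I hX0 t
    rw [hEq]
    have h1 : ‖∑ a ∈ Finset.Icc 1 N, cmDefect f a * (a : ℂ) ^ (-(1 + (t : ℂ) * Complex.I)) * G a t‖ ≤
        ∑ a ∈ Finset.Icc 1 N, c a * ((a : ℝ) ^ (-(1 / 3 : ℝ)) * ‖G a t‖) := by
      refine (norm_sum_le _ _).trans (Finset.sum_le_sum fun a ha => ?_)
      have ha0 : 0 < a := (Finset.mem_Icc.1 ha).1
      have ha0' : (0 : ℝ) < a := by exact_mod_cast ha0
      rw [norm_mul, norm_mul, Complex.norm_natCast_cpow_of_pos ha0]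
      simp only [Complex.neg_re, Complex.add_re, Complex.one_re, Complex.mul_re, Complex.ofReal_re,
        Complex.I_re, mul_zero, Complex.ofReal_im, Complex.I_im, mul_one, sub_self, add_zero]
      have e : (a : ℝ) ^ (-(1 : ℝ)) = (a : ℝ) ^ (-(2 / 3 : ℝ)) * (a : ℝ) ^ (-(1 / 3 : ℝ)) := by
        rw [← Real.rpow_add ha0']; norm_num
      rw [e]
      exact le_of_eq (by simp only [hc]; ring)
    have h2 : (∑ a ∈ Finset.Icc 1 N, c a * ((a : ℝ) ^ (-(1 / 3 : ℝ)) * ‖G a t‖)) ^ 2 ≤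
        (∑ a ∈ Finset.Icc 1 N, c a) *
          ∑ a ∈ Finset.Icc 1 N, c a * ((a : ℝ) ^ (-(1 / 3 : ℝ)) * ‖G a t‖) ^ 2 :=
      Finset.sum_sq_le_sum_mul_sum_of_sq_le_mul _ (fun a _ => hc0 a)
        (fun a _ => mul_nonneg (hc0 a) (sq_nonneg _)) (fun a _ => le_of_eq (by ring))
    have e2 : ∀ a ∈ Finset.Icc 1 N, c a * ((a : ℝ) ^ (-(1 / 3 : ℝ)) * ‖G a t‖) ^ 2 =
        c a * ((a : ℝ) ^ (-(2 / 3 : ℝ)) * ‖G a t‖ ^ 2) := by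
      intro a ha
      have ha0' : (0 : ℝ) ≤ a := Nat.cast_nonneg a
      have : ((a : ℝ) ^ (-(1 / 3 : ℝ))) ^ 2 = (a : ℝ) ^ (-(2 / 3 : ℝ)) := by
        rw [← Real.rpow_natCast, ← Real.rpow_mul ha0']; norm_num
      rw [mul_pow, this]
    rw [Finset.sum_congr rfl e2] at h2
    have hs0 : 0 ≤ ∑ a ∈ Finset.Icc 1 N, c a * ((a : ℝ) ^ (-(2 / 3 : ℝ)) * ‖G a t‖ ^ 2) :=
      Finset.sum_nonneg fun a _ => mul_nonneg (hc0 a) (by positivity)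
    calc ‖∑ a ∈ Finset.Icc 1 N, cmDefect f a * (a : ℂ) ^ (-(1 + (t : ℂ) * Complex.I)) * G a t‖ ^ 2
        ≤ (∑ a ∈ Finset.Icc 1 N, c a * ((a : ℝ) ^ (-(1 / 3 : ℝ)) * ‖G a t‖)) ^ 2 :=
          pow_le_pow_left₀ (norm_nonneg _) h1 2
      _ ≤ (∑ a ∈ Finset.Icc 1 N, c a) * ∑ a ∈ Finset.Icc 1 N, c a * ((a : ℝ) ^ (-(2 / 3 : ℝ)) * ‖G a t‖ ^ 2) := h2
      _ ≤ cmDefectBound * ∑ a ∈ Finset.Icc 1 N, c a * ((a : ℝ) ^ (-(2 / 3 : ℝ)) * ‖G a t‖ ^ 2) :=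
          mul_le_mul_of_nonneg_right hcsum hs0
  -- per fibre: the window theorem at scale `X/a'` for `a' ≤ A`, the trivial bound for `a' > A`
  have hcontG : ∀ a' : ℕ, Continuous fun t : ℝ => ‖G a' t‖ ^ 2 := fun a' =>
    ((continuous_finsetSum _ fun m _ => continuous_const.mul (continuous_natCast_cpow_neg m)).norm).pow 2
  have hfib : ∀ a' ∈ Finset.Icc 1 N, c a' * ((a' : ℝ) ^ (-(2 / 3 : ℝ)) * ∫ t in a..b, ‖G a' t‖ ^ 2) ≤
      c a' * (K * (Real.exp (-M) + 1 / ℓ ^ (1 / 50 : ℝ)) + 16 * (1 / ℓ ^ (1 / 50 : ℝ))) := by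
    intro a' ha'
    have ha'1 : 1 ≤ a' := (Finset.mem_Icc.1 ha').1
    have ha'0 : (0 : ℝ) < a' := by exact_mod_cast ha'1
    have ha'1r : (1 : ℝ) ≤ a' := by exact_mod_cast ha'1
    have hsq1 : (a' : ℝ) ^ (-(2 / 3 : ℝ)) ≤ 1 := Real.rpow_le_one_of_one_le_of_nonpos ha'1r (by norm_num)
    have hint0 : 0 ≤ ∫ t in a..b, ‖G a' t‖ ^ 2 :=
      intervalIntegral.integral_nonneg hab fun t _ => by positivity
    have hKE0 : 0 ≤ K * (Real.exp (-M) + 1 / ℓ ^ (1 / 50 : ℝ)) := by positivity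
    have hE0 : 0 ≤ 16 * (1 / ℓ ^ (1 / 50 : ℝ)) := by positivity
    refine mul_le_mul_of_nonneg_left ?_ (hc0 a')
    by_cases hsmall : (a' : ℝ) ≤ A
    · -- the window theorem at the scale `X / a'` for the sub-family `𝓙a a'`
      have hY : X ≤ X / a' * A := by
        rw [div_mul_eq_mul_div, le_div_iff₀ ha'0]
        nlinarith [mul_le_mul_of_nonneg_left hsmall hX0.le]
      have hYle : X / a' ≤ X := div_le_self hX0.le ha'1r
      have hsub : 𝓙a a' ⊆ Finset.Icc 1 I.J := Finset.filter_subset _ _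
      have hmin' : pretentiousDistSq (cmLift f) (fun n : ℕ => (n : ℂ) ^ ((t₁ : ℂ) * Complex.I)) X ≤
          minPretentiousDistSq (cmLift f) X X + 1 := by
        rw [pretentiousDistSq_cmLift, minPretentiousDistSq_cmLift]; exact hmin
      have hwin := hW η X₀ I (𝓙a a') (cmLift f) hη hη1 hcm_mul hcm_one hcm_b hX₀ hX₀X hsub (X / a') t₁ a b
        hY hYle hmin' hab ha hb haX hbX
      rw [minPretentiousDistSq_cmLift] at hwin
      have hwin' : ∫ t in a..b, ‖G a' t‖ ^ 2 ≤ K * (Real.exp (-M) + 1 / ℓ ^ (1 / 50 : ℝ)) := hwin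
      calc (a' : ℝ) ^ (-(2 / 3 : ℝ)) * ∫ t in a..b, ‖G a' t‖ ^ 2 ≤ 1 * (K * (Real.exp (-M) + 1 / ℓ ^ (1 / 50 : ℝ))) :=
            mul_le_mul hsq1 hwin' hint0 zero_le_one
        _ ≤ K * (Real.exp (-M) + 1 / ℓ ^ (1 / 50 : ℝ)) + 16 * (1 / ℓ ^ (1 / 50 : ℝ)) := by linarith
    · -- `a' > A`: the trivial bound `‖G_{a'}‖ ≤ 2` and `a'^{-1/2} ≤ A^{-1/2}`
      push Not at hsmall
      have hG2 : ∀ t, ‖G a' t‖ ^ 2 ≤ 4 := fun t => by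
        have h : ‖G a' t‖ ≤ 2 := norm_fibre_le hcm_b (div_pos hX0 ha'0) (𝓙a a') blk t
        nlinarith [norm_nonneg (G a' t)]
      have hint4 : ∫ t in a..b, ‖G a' t‖ ^ 2 ≤ 4 * (b - a) := by
        have h : ∫ t in a..b, ‖G a' t‖ ^ 2 ≤ ∫ _ in a..b, (4 : ℝ) :=
          intervalIntegral.integral_mono_on hab ((hcontG a').intervalIntegrable _ _)
            intervalIntegrable_const (fun t _ => hG2 t)
        rwa [intervalIntegral.integral_const, smul_eq_mul, mul_comm] at h
      have hba : b - a ≤ 4 * L := by linarith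
      have hpow : (a' : ℝ) ^ (-(2 / 3 : ℝ)) ≤ A ^ (-(2 / 3 : ℝ)) :=
        Real.rpow_le_rpow_of_nonpos hA0 hsmall.le (by norm_num)
      have hApow : A ^ (-(2 / 3 : ℝ)) * L = ℓ ^ (-(5 / 48 : ℝ)) := by
        rw [hAdef, hLdef, ← Real.rpow_mul hℓ0.le, ← Real.rpow_add hℓ0]; norm_num
      have hℓpow : ℓ ^ (-(5 / 48 : ℝ)) ≤ 1 / ℓ ^ (1 / 50 : ℝ) := by
        have e : 1 / ℓ ^ (1 / 50 : ℝ) = ℓ ^ (-(1 / 50 : ℝ)) := by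
          rw [Real.rpow_neg hℓ0.le, inv_eq_one_div]
        rw [e]
        exact Real.rpow_le_rpow_of_exponent_le hℓ1 (by norm_num)
      have hA2 : 0 ≤ A ^ (-(2 / 3 : ℝ)) := Real.rpow_nonneg hA0.le _
      calc (a' : ℝ) ^ (-(2 / 3 : ℝ)) * ∫ t in a..b, ‖G a' t‖ ^ 2 ≤ A ^ (-(2 / 3 : ℝ)) * (4 * (4 * L)) :=
            mul_le_mul hpow (hint4.trans (by linarith)) hint0 hA2
        _ = 16 * (A ^ (-(2 / 3 : ℝ)) * L) := by ring
        _ ≤ 16 * (1 / ℓ ^ (1 / 50 : ℝ)) := by rw [hApow]; exact mul_le_mul_of_nonneg_left hℓpow (by norm_num)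
        _ ≤ K * (Real.exp (-M) + 1 / ℓ ^ (1 / 50 : ℝ)) + 16 * (1 / ℓ ^ (1 / 50 : ℝ)) := by linarith
  -- integrate the pointwise bound
  have hcontF : Continuous fun t : ℝ => ‖restrDirichlet f I X t‖ ^ 2 :=
    ((continuous_restrDirichlet f I X).norm).pow 2
  have hcontR : Continuous fun t : ℝ =>
      cmDefectBound * ∑ a' ∈ Finset.Icc 1 N, c a' * ((a' : ℝ) ^ (-(2 / 3 : ℝ)) * ‖G a' t‖ ^ 2) :=
    continuous_const.mul (continuous_finsetSum _ fun a' _ => continuous_const.mul (continuous_const.mul (hcontG a')))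
  have hB0 : 0 ≤ K * (Real.exp (-M) + 1 / ℓ ^ (1 / 50 : ℝ)) + 16 * (1 / ℓ ^ (1 / 50 : ℝ)) := by positivity
  calc ∫ t in a..b, ‖restrDirichlet f I X t‖ ^ 2
      ≤ ∫ t in a..b, cmDefectBound * ∑ a' ∈ Finset.Icc 1 N, c a' * ((a' : ℝ) ^ (-(2 / 3 : ℝ)) * ‖G a' t‖ ^ 2) :=
        intervalIntegral.integral_mono_on hab (hcontF.intervalIntegrable _ _) (hcontR.intervalIntegrable _ _)
          fun t _ => hpt t
    _ = cmDefectBound * ∑ a' ∈ Finset.Icc 1 N, c a' * ((a' : ℝ) ^ (-(2 / 3 : ℝ)) * ∫ t in a..b, ‖G a' t‖ ^ 2) := by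
        rw [intervalIntegral.integral_const_mul, intervalIntegral.integral_finsetSum]
        · congr 1
          refine Finset.sum_congr rfl fun a' _ => ?_
          rw [intervalIntegral.integral_const_mul, intervalIntegral.integral_const_mul]
        · intro a' _
          exact (continuous_const.mul (continuous_const.mul (hcontG a'))).intervalIntegrable _ _
    _ ≤ cmDefectBound * ∑ a' ∈ Finset.Icc 1 N,
          c a' * (K * (Real.exp (-M) + 1 / ℓ ^ (1 / 50 : ℝ)) + 16 * (1 / ℓ ^ (1 / 50 : ℝ))) :=
        mul_le_mul_of_nonneg_left (Finset.sum_le_sum hfib) hCB.le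
    _ = cmDefectBound * (∑ a' ∈ Finset.Icc 1 N, c a') *
          (K * (Real.exp (-M) + 1 / ℓ ^ (1 / 50 : ℝ)) + 16 * (1 / ℓ ^ (1 / 50 : ℝ))) := by
        rw [← Finset.sum_mul]; ring
    _ ≤ cmDefectBound * cmDefectBound * (K * (Real.exp (-M) + 1 / ℓ ^ (1 / 50 : ℝ)) + 16 * (1 / ℓ ^ (1 / 50 : ℝ))) := by
        have h1 := mul_le_mul_of_nonneg_left hcsum hCB.le
        exact mul_le_mul_of_nonneg_right h1 hB0
    _ ≤ cmDefectBound * cmDefectBound * (K + 16) * (Real.exp (-M) + 1 / ℓ ^ (1 / 50 : ℝ)) := by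
        have h1 : 0 ≤ Real.exp (-M) := (Real.exp_pos _).le
        have h2 : 0 ≤ 1 / ℓ ^ (1 / 50 : ℝ) := by positivity
        have h3 : 0 ≤ cmDefectBound * cmDefectBound := by positivity
        have h4 : K * (Real.exp (-M) + 1 / ℓ ^ (1 / 50 : ℝ)) + 16 * (1 / ℓ ^ (1 / 50 : ℝ)) ≤
            (K + 16) * (Real.exp (-M) + 1 / ℓ ^ (1 / 50 : ℝ)) := by nlinarith
        calc cmDefectBound * cmDefectBound * (K * (Real.exp (-M) + 1 / ℓ ^ (1 / 50 : ℝ)) + 16 * (1 / ℓ ^ (1 / 50 : ℝ)))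
            ≤ cmDefectBound * cmDefectBound * ((K + 16) * (Real.exp (-M) + 1 / ℓ ^ (1 / 50 : ℝ))) :=
              mul_le_mul_of_nonneg_left h4 h3
          _ = _ := by ring

/-! ### Part 2: Proposition A.3 -/

open ArithmeticFunction

set_option maxHeartbeats 1600000 in
/-- **Proposition A.3 for multiplicative `f`, with middle term `K e^{-M}`**: there is an absolute `K ≥ 0` such that
for every `η ∈ (0, 1/6)` there are `C, X(η)` with
`∫_0^T |F(1+it)|² dt ≤ C (T/(X/Q₁) + 1) ((log Q₁)^{1/3}/P₁^{1/6-η} + K e^{-M(f;X)} + (log X)^{-1/50})`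
for all `X > X(η)`, `√X ≤ X₀ ≤ X`, `T ≥ 0`, every `I : SieveIntervalSystem η X₀` and every multiplicative
`f : ArithmeticFunction ℂ` with `|f| ≤ 1` (`F = restrDirichlet f I X`, `M(f;X) = minPretentiousDistSq f X X`).
See the module docstring for the proof. [cite: MatomakiRadziwillTao2015, Appendix A, Proposition A.3] -/
theorem propA3_mult_exp :
    ∃ K : ℝ, 0 ≤ K ∧ ∀ η : ℝ, 0 < η → η < 1 / 6 → ∃ C Xη : ℝ, ∀ (X X₀ T : ℝ) (I : SieveIntervalSystem η X₀)
      (f : ArithmeticFunction ℂ), f.IsMultiplicative → (∀ n, ‖f n‖ ≤ 1) →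
      Xη < X → Real.sqrt X ≤ X₀ → X₀ ≤ X → 0 ≤ T →
      ∫ t in (0 : ℝ)..T, ‖restrDirichlet f I X t‖ ^ 2 ≤
        C * (T / (X / I.Q 1) + 1) *
          (Real.log (I.Q 1) ^ (1 / 3 : ℝ) / (I.P 1) ^ (1 / 6 - η) + K * Real.exp (-minPretentiousDistSq f X X) +
            1 / Real.log X ^ (1 / 50 : ℝ)) := by
  obtain ⟨cVK, hcVK, hVK⟩ := VKZeta.exists_hasVKZeroFreeRegion
  obtain ⟨K, hK0, hWev⟩ := integral_sq_restrDirichlet_window_le_exp_mult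
  obtain ⟨Xw, hW⟩ := Filter.eventually_atTop.1 hWev
  refine ⟨K, hK0.le, ?_⟩
  intro η hη hη6
  obtain ⟨C₂, Xη, hC₂0, hT2'⟩ := T2one_mult_of_vk hcVK hVK η hη hη6
  refine ⟨2 * (2 * C₂ + K + 200), max (max Xη Xw) 64, ?_⟩
  intro X X₀ T I f hf hfb hXη hX₀ hX₀X hT0
  have hXη' : Xη < X := lt_of_le_of_lt ((le_max_left _ _).trans (le_max_left _ _)) hXη
  have hXw : Xw ≤ X := ((le_max_right _ _).trans (le_max_left _ _)).trans hXη.le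
  have hX64 : 64 ≤ X := (le_max_right _ _).trans hXη.le
  have hX0 : 0 < X := by linarith
  have hX1 : 1 ≤ X := by linarith
  have hη8 : η ≤ 8 := by linarith
  -- notation for the error terms
  set E₁ : ℝ := Real.log (I.Q 1) ^ (1 / 3 : ℝ) / I.P 1 ^ (1 / 6 - η) with hE₁
  set E₃ : ℝ := 1 / Real.log X ^ (1 / 50 : ℝ) with hE₃
  set M : ℝ := minPretentiousDistSq f X X with hMdef
  set mid : ℝ := K * Real.exp (-M) with hmid
  have hQ1 : 1 ≤ I.Q 1 := I.one_le_Q hη hη8 le_rfl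
  have hQ0 : 0 < I.Q 1 := by linarith
  have hlogX : 0 < Real.log X := Real.log_pos (by linarith)
  have hP0 : 0 < I.P 1 := I.pos_P 1 le_rfl
  have hE₁0 : 0 ≤ E₁ := by
    have : 0 ≤ Real.log (I.Q 1) := Real.log_nonneg hQ1
    positivity
  have hE₃0 : 0 ≤ E₃ := by positivity
  have hM0 : 0 ≤ M := minPretentiousDistSq_nonneg hfb X hX0.le
  have hmid0 : 0 ≤ mid := by positivity
  -- `Q₁ ≤ X`
  have hQX : I.Q 1 ≤ X := by
    have hsX : 0 < Real.sqrt X := Real.sqrt_pos.2 hX0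
    have hX₀0 : 0 < X₀ := hsX.trans_le hX₀
    have h1 : I.Q 1 ≤ I.Q I.J := Q_le_Q_J I hη hη8 le_rfl I.one_le_J
    have h2 : I.Q I.J ≤ Real.exp (Real.sqrt (Real.log X)) :=
      I.Q_J_le.trans (Real.exp_le_exp.2 (Real.sqrt_le_sqrt (Real.log_le_log hX₀0 hX₀X)))
    have he : Real.exp 1 ≤ X := by
      have := Real.exp_one_lt_d9; linarith
    exact h1.trans (h2.trans (exp_sqrt_log_le he))
  have hcont : Continuous fun t : ℝ => ‖restrDirichlet f I X t‖ ^ 2 :=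
    ((continuous_restrDirichlet f I X).norm).pow 2
  have hint : ∀ a b : ℝ, IntervalIntegrable (fun t : ℝ => ‖restrDirichlet f I X t‖ ^ 2) volume a b :=
    fun a b => hcont.intervalIntegrable _ _
  have hnn : ∀ a b : ℝ, a ≤ b → 0 ≤ ∫ t in a..b, ‖restrDirichlet f I X t‖ ^ 2 := fun a b hab =>
    intervalIntegral.integral_nonneg hab fun t _ => by positivity
  -- the bound for `T' ≥ 1`, with `R(T') = T'/(X/Q₁) + 1`
  have key : ∀ T' : ℝ, 1 ≤ T' → ∫ t in (0 : ℝ)..T', ‖restrDirichlet f I X t‖ ^ 2 ≤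
      (2 * C₂ + K + 200) * (T' / (X / I.Q 1) + 1) * (E₁ + mid + E₃) := by
    intro T' hT1
    have hT0' : 0 ≤ T' := by linarith
    set R : ℝ := T' / (X / I.Q 1) + 1 with hR
    have hR1 : 1 ≤ R := by
      have : 0 ≤ T' / (X / I.Q 1) := by positivity
      linarith
    have hR0 : 0 ≤ R := by linarith
    have hRdef : R = T' * I.Q 1 / X + 1 := by rw [hR]; field_simp
    rcases le_or_gt (X / 2) T' with hTX | hTX
    · -- `T' ≥ X/2`: the trivial bound
      have hT : 0 < T' := by linarith
      have h1 := integral_restrDirichlet_trivial_le hfb I hX1 le_rfl hT0' hT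
      have h2 : 10 * T' / X + 72 ≤ 154 * (T' / X) := by
        have : 1 / 2 ≤ T' / X := by rw [div_le_div_iff₀ (by norm_num) hX0]; linarith
        have h' : 10 * T' / X = 10 * (T' / X) := by ring
        rw [h']; linarith
      have h3 : T' / X ≤ R * E₁ := by
        have h4 := one_le_Q_one_mul_err I hη hη6
        have hTX0 : 0 ≤ T' / X := by positivity
        calc T' / X = T' / X * 1 := (mul_one _).symm
          _ ≤ T' / X * (I.Q 1 * E₁) := mul_le_mul_of_nonneg_left h4 hTX0
          _ = (T' * I.Q 1 / X) * E₁ := by ring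
          _ ≤ R * E₁ := by rw [hRdef]; exact mul_le_mul_of_nonneg_right (by linarith) hE₁0
      have h5 : R * E₁ ≤ R * (E₁ + mid + E₃) := mul_le_mul_of_nonneg_left (by linarith) hR0
      have h6 : 0 ≤ R * (E₁ + mid + E₃) := by positivity
      nlinarith
    · -- `1 ≤ T' < X/2`: split `[0, T']`
      obtain ⟨t₁, ht₁, -, heq⟩ := Halasz.Restricted.exists_isMinOn_pretentiousDistSq_twist hfb X hX0.le
      set L : ℝ := Real.log X ^ (1 / 16 : ℝ) with hL
      have hL1 : 1 ≤ L := by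
        have hlogX1 : 1 ≤ Real.log X := by
          rw [← Real.log_exp 1]
          exact Real.log_le_log (Real.exp_pos 1) (by have := Real.exp_one_lt_d9; linarith)
        exact Real.one_le_rpow hlogX1 (by norm_num)
      have hL0 : 0 < L := by linarith
      set a₀ : ℝ := max 0 (min T' (t₁ - L)) with ha₀
      set a : ℝ := if a₀ < 1 then 0 else a₀ with ha
      set b : ℝ := max 0 (min T' (t₁ + L)) with hb
      have ha₀0 : 0 ≤ a₀ := le_max_left _ _
      have ha0 : 0 ≤ a := by rw [ha]; split_ifs <;> linarith
      have hb0 : 0 ≤ b := le_max_left _ _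
      have ha₀T : a₀ ≤ T' := max_le hT0' (min_le_left _ _)
      have haa₀ : a ≤ a₀ := by rw [ha]; split_ifs <;> linarith
      have haT : a ≤ T' := haa₀.trans ha₀T
      have hbT : b ≤ T' := max_le hT0' (min_le_left _ _)
      have ha₀b : a₀ ≤ b := max_le_max le_rfl (min_le_min le_rfl (by linarith))
      have hab : a ≤ b := haa₀.trans ha₀b
      -- the three pieces
      rw [← intervalIntegral.integral_add_adjacent_intervals (hint 0 a) (hint a T'),
        ← intervalIntegral.integral_add_adjacent_intervals (hint a b) (hint b T')]
      -- piece `[0, a]`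
      have hA : ∫ t in (0 : ℝ)..a, ‖restrDirichlet f I X t‖ ^ 2 ≤ C₂ * R * (E₁ + E₃) := by
        by_cases hsmall : a₀ < 1
        · have : a = 0 := by rw [ha, if_pos hsmall]
          rw [this, intervalIntegral.integral_same]; positivity
        · have haeq : a = a₀ := by rw [ha, if_neg hsmall]
          push Not at hsmall
          -- `a = a₀ ≥ 1 > 0`, so `a₀ = min T' (t₁ - L) ≤ t₁ - L`
          have ha' : a ≤ t₁ - L := by
            rw [haeq]
            have hpos : 0 < min T' (t₁ - L) := by
              by_contra hle
              push Not at hle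
              have : a₀ = 0 := by rw [ha₀, max_eq_left hle]
              linarith
            have : a₀ = min T' (t₁ - L) := max_eq_right hpos.le
            rw [this]; exact min_le_right _ _
          have hfar : ∀ t ∈ Set.Icc 0 a, L ≤ |t - t₁| := by
            intro t ht
            rw [abs_sub_comm, abs_of_nonneg (by linarith [ht.2])]
            linarith [ht.2]
          have ha1 : 1 ≤ a := by rw [haeq]; exact hsmall
          have h := hT2' X X₀ 0 a t₁ I f hf hfb hXη' hX₀ hX₀X ht₁ heq le_rfl ha0 ha1 (by linarith) hfar
          refine h.trans ?_
          have hRa : a / (X / I.Q 1) + 1 ≤ R := by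
            rw [hR]; gcongr
          have hEE : 0 ≤ E₁ + E₃ := by positivity
          exact mul_le_mul_of_nonneg_right (mul_le_mul_of_nonneg_left hRa hC₂0) hEE
      -- piece `[b, T']`
      have hB : ∫ t in b..T', ‖restrDirichlet f I X t‖ ^ 2 ≤ C₂ * R * (E₁ + E₃) := by
        rcases eq_or_lt_of_le hbT with h0 | h0
        · rw [h0, intervalIntegral.integral_same]; positivity
        · have hb' : t₁ + L ≤ b := by
            have hmin : min T' (t₁ + L) = t₁ + L := by
              rcases le_or_gt T' (t₁ + L) with h' | h'
              · exfalso
                have : b = T' := by rw [hb, min_eq_left h', max_eq_right hT0']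
                exact lt_irrefl _ (this ▸ h0)
              · exact min_eq_right h'.le
            rw [hb, hmin]; exact le_max_right _ _
          have hfar : ∀ t ∈ Set.Icc b T', L ≤ |t - t₁| := by
            intro t ht
            rw [abs_of_nonneg (by linarith [ht.1])]
            linarith [ht.1]
          have h := hT2' X X₀ b T' t₁ I f hf hfb hXη' hX₀ hX₀X ht₁ heq hb0 hbT hT1 (by linarith) hfar
          refine h.trans ?_
          have hEE : 0 ≤ E₁ + E₃ := by positivity
          gcongr
      -- piece `[a, b]`: the window (half-width `2L`)
      have hWin : ∫ t in a..b, ‖restrDirichlet f I X t‖ ^ 2 ≤ K * (Real.exp (-M) + E₃) := by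
        rcases eq_or_lt_of_le hab with h0 | h0
        · rw [← h0, intervalIntegral.integral_same]; positivity
        · -- `a < b`: `t₁ - 2L ≤ a` and `b ≤ t₁ + L`
          have ha' : t₁ - 2 * L ≤ a := by
            by_cases hsmall : a₀ < 1
            · have haz : a = 0 := by rw [ha, if_pos hsmall]
              -- `a₀ < 1` forces `t₁ - L < 1` (as `T' ≥ 1`), so `t₁ - 2L < 1 - L ≤ 0`
              have : t₁ - L < 1 := by
                by_contra hge
                push Not at hge
                have h1 : 1 ≤ min T' (t₁ - L) := le_min hT1 hge
                have h2 : min T' (t₁ - L) ≤ a₀ := le_max_right _ _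
                linarith
              rw [haz]; linarith
            · have haeq : a = a₀ := by rw [ha, if_neg hsmall]
              have haT' : a₀ < T' := by
                have : a < T' := lt_of_lt_of_le h0 hbT
                rwa [haeq] at this
              have hmin : min T' (t₁ - L) = t₁ - L := by
                rcases le_or_gt T' (t₁ - L) with h' | h'
                · exfalso
                  have : a₀ = T' := by rw [ha₀, min_eq_left h', max_eq_right hT0']
                  exact lt_irrefl _ (this ▸ haT')
                · exact min_eq_right h'.le
              have : t₁ - L ≤ a₀ := by rw [ha₀, hmin]; exact le_max_right _ _
              rw [haeq]; linarith
          have hb' : b ≤ t₁ + L := by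
            have hb0' : 0 < b := lt_of_le_of_lt ha0 h0
            have : b = min T' (t₁ + L) := max_eq_right (le_of_lt (by
              rcases lt_or_ge 0 (min T' (t₁ + L)) with h' | h'
              · exact h'
              · exfalso; rw [hb, max_eq_left h'] at hb0'; exact lt_irrefl _ hb0'))
            rw [this]; exact min_le_right _ _
          have h := hW X hXw η X₀ I f hη (by linarith) hf hfb hX₀ hX₀X t₁ a b
            (heq.le.trans (le_add_of_nonneg_right zero_le_one)) hab ha'
            (by linarith) (by linarith) (by linarith)
          simpa only [hE₃] using h
      -- combine
      have hWin' : K * (Real.exp (-M) + E₃) ≤ R * (mid + K * E₃) := by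
        have h1 : K * (Real.exp (-M) + E₃) = mid + K * E₃ := by rw [hmid]; ring
        rw [h1]
        exact le_mul_of_one_le_left (by positivity) hR1
      have hsum := add_le_add hA (add_le_add hWin hB)
      refine hsum.trans ?_
      have h1 : 0 ≤ C₂ * R * mid := by positivity
      have h2 : 0 ≤ K * R * E₁ := by positivity
      have h3 : 0 ≤ K * R * mid := by positivity
      have h4 : 0 ≤ R * mid := by positivity
      have h5 : 0 ≤ R * E₁ := by positivity
      have h6 : 0 ≤ R * E₃ := by positivity
      nlinarith [hWin', h1, h2, h3, h4, h5, h6]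
  -- the general `T ≥ 0`: apply `key` at `T' = max T 1` and compare
  set T' : ℝ := max T 1 with hT'
  have hT1 : 1 ≤ T' := le_max_right _ _
  have hTT' : T ≤ T' := le_max_left _ _
  have hmono : ∫ t in (0 : ℝ)..T, ‖restrDirichlet f I X t‖ ^ 2 ≤ ∫ t in (0 : ℝ)..T', ‖restrDirichlet f I X t‖ ^ 2 :=
    intervalIntegral.integral_mono_interval le_rfl hT0 hTT' (Filter.Eventually.of_forall fun t => by positivity)
      (hint _ _)
  refine hmono.trans ((key T' hT1).trans ?_)
  -- `R(T') ≤ 2 R(T)` since `T' ≤ T + 1` and `Q₁ ≤ X`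
  have hR : T' / (X / I.Q 1) + 1 ≤ 2 * (T / (X / I.Q 1) + 1) := by
    have hT'le : T' ≤ T + 1 := max_le (by linarith) (by linarith)
    have e1 : T' / (X / I.Q 1) = T' * I.Q 1 / X := by field_simp
    have e2 : T / (X / I.Q 1) = T * I.Q 1 / X := by field_simp
    rw [e1, e2, div_add_one (by positivity), div_add_one (by positivity), ← mul_div_assoc 2,
      div_le_div_iff_of_pos_right hX0]
    nlinarith [mul_le_mul_of_nonneg_right hT'le hQ0.le, hQX, hT0]
  have hE0 : 0 ≤ E₁ + mid + E₃ := by positivity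
  have hC0 : 0 ≤ 2 * C₂ + K + 200 := by linarith
  calc (2 * C₂ + K + 200) * (T' / (X / I.Q 1) + 1) * (E₁ + mid + E₃)
      ≤ (2 * C₂ + K + 200) * (2 * (T / (X / I.Q 1) + 1)) * (E₁ + mid + E₃) := by gcongr
    _ = 2 * (2 * C₂ + K + 200) * (T / (X / I.Q 1) + 1) * (E₁ + mid + E₃) := by ring

/-- **Proposition A.3 in the schema form, middle term `K e^{-M}`** (completely multiplicative `f`; better than the
printed `(1+M)e^{-M}`). [cite: MatomakiRadziwillTao2015, Appendix A, Proposition A.3] -/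
theorem propA3With_exp : ∃ K : ℝ, 0 ≤ K ∧ PropA3With (fun M => K * Real.exp (-M)) := by
  obtain ⟨K, hK0, h⟩ := propA3_mult_exp
  refine ⟨K, hK0, fun η hη hη6 => ?_⟩
  obtain ⟨C, Xη, hC⟩ := h η hη hη6
  refine ⟨C, Xη, fun X X₀ T I f hf hf1 hfb hXη hX₀ hX₀X hT => ?_⟩
  exact hC X X₀ T I f (isMultiplicative_of_cm hf hf1) hfb hXη hX₀ hX₀X hT

end MRT2015

open MRT2015 in
/-- **Matomäki–Radziwiłł–Tao 2015, Proposition A.3** (Algebra & Number Theory 9 (2015), Appendix A; arXiv:1503.05121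
§6, Proposition 6.3) — the named fact `MatomakiRadziwillTao2015_propA3` holds: for every `η ∈ (0, 1/6)` there are
`C, X(η)` such that for `X > X(η)`, `√X ≤ X₀ ≤ X`, `T ≥ 0`, every interval system `I : SieveIntervalSystem η X₀`
and every multiplicative `f : ArithmeticFunction ℂ` with `|f| ≤ 1`,
`∫_0^T |F(1+it)|² dt ≤ C (T/(X/Q₁) + 1) ((log Q₁)^{1/3}/P₁^{1/6-η} + (1+M)e^{-M} + (log X)^{-1/50})`,
`M = M(f;X)`.  From `MRT2015.propA3_mult_exp` (middle term `K e^{-M} ≤ max(K,1) (1+M) e^{-M}`).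
[cite: MatomakiRadziwillTao2015, Appendix A, Proposition A.3] -/
theorem MatomakiRadziwillTao2015_propA3_holds : MatomakiRadziwillTao2015_propA3 := by
  obtain ⟨K, hK0, h⟩ := propA3_mult_exp
  intro η hη hη6
  obtain ⟨C, Xη, hC⟩ := h η hη hη6
  refine ⟨max C 0 * max K 1, max Xη 1, ?_⟩
  intro X X₀ T I f hf hfb hXη hX₀ hX₀X hT
  have hXη' : Xη < X := lt_of_le_of_lt (le_max_left _ _) hXη
  have hX1 : 1 < X := lt_of_le_of_lt (le_max_right _ _) hXη
  have hX0 : 0 < X := by linarith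
  have h1 := hC X X₀ T I f hf hfb hXη' hX₀ hX₀X hT
  have hη8 : η ≤ 8 := by linarith
  have hQ1 : 1 ≤ I.Q 1 := I.one_le_Q hη hη8 le_rfl
  have hQ0 : 0 < I.Q 1 := by linarith
  have hP0 : 0 < I.P 1 := I.pos_P 1 le_rfl
  have hlogX : 0 < Real.log X := Real.log_pos hX1
  unfold errA3
  set M : ℝ := Sieve.minPretentiousDistSq f X X with hMdef
  set E₁ : ℝ := Real.log (I.Q 1) ^ (1 / 3 : ℝ) / I.P 1 ^ (1 / 6 - η) with hE₁
  set E₃ : ℝ := 1 / Real.log X ^ (1 / 50 : ℝ) with hE₃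
  set R : ℝ := T / (X / I.Q 1) + 1 with hR
  have hM0 : 0 ≤ M := Sieve.minPretentiousDistSq_nonneg hfb X hX0.le
  have hE₁0 : 0 ≤ E₁ := by
    have : 0 ≤ Real.log (I.Q 1) := Real.log_nonneg hQ1
    positivity
  have hE₃0 : 0 ≤ E₃ := by positivity
  have hR0 : 0 ≤ R := by positivity
  have hE0 : 0 ≤ E₁ + K * Real.exp (-M) + E₃ := by positivity
  have h2 : C * R * (E₁ + K * Real.exp (-M) + E₃) ≤ max C 0 * R * (E₁ + K * Real.exp (-M) + E₃) := by
    have h0 := mul_nonneg hR0 hE0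
    have hC : C ≤ max C 0 := le_max_left _ _
    nlinarith
  have hK1 : K ≤ max K 1 := le_max_left _ _
  have h1K : 1 ≤ max K 1 := le_max_right _ _
  have h3 : E₁ + K * Real.exp (-M) + E₃ ≤ max K 1 * (E₁ + (1 + M) * Real.exp (-M) + E₃) := by
    have he : 0 < Real.exp (-M) := Real.exp_pos _
    have a1 : E₁ ≤ max K 1 * E₁ := le_mul_of_one_le_left hE₁0 h1K
    have a3 : E₃ ≤ max K 1 * E₃ := le_mul_of_one_le_left hE₃0 h1K
    have a2 : K * Real.exp (-M) ≤ max K 1 * ((1 + M) * Real.exp (-M)) := by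
      calc K * Real.exp (-M) ≤ max K 1 * Real.exp (-M) := mul_le_mul_of_nonneg_right hK1 he.le
        _ ≤ max K 1 * ((1 + M) * Real.exp (-M)) := by
            refine mul_le_mul_of_nonneg_left ?_ (by linarith)
            nlinarith
    nlinarith
  calc ∫ t in (0 : ℝ)..T, ‖restrDirichlet f I X t‖ ^ 2 ≤ C * R * (E₁ + K * Real.exp (-M) + E₃) := h1
    _ ≤ max C 0 * R * (E₁ + K * Real.exp (-M) + E₃) := h2
    _ ≤ max C 0 * R * (max K 1 * (E₁ + (1 + M) * Real.exp (-M) + E₃)) :=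
        mul_le_mul_of_nonneg_left h3 (mul_nonneg (le_max_right _ _) hR0)
    _ = max C 0 * max K 1 * R * (E₁ + (1 + M) * Real.exp (-M) + E₃) := by ring

end Literature.NumberTheory.LFunctions
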